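import Literature.NumberTheory.Automorphic.ArchimedeanLieBracket
import Literature.NumberTheory.Automorphic.AutomorphicFormsKTranslates
import HarnessLib

/-!
# The action of `U(𝔤)` on archimedean-smooth functions; `Z(𝔤)`-finiteness of Lie derivatives
(discharge of the named fact `applyFree_congr` of `ArchimedeanCalculus` for `𝔤 = 𝔤𝔩(N, A)`)

Topic `NumberTheory/Automorphic`. Let `H : RealMatrixGroup A N` be the full linear group
(`H.lie = ⊤`, `H.carrier = ⊤`; e.g. the archimedean group `archGroupGL n K = GL_n(K_∞)` of the
`GL_n` automorphy datum) over a finite-dimensional coefficient algebra, and `ι : H → G` a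
homomorphism into a group. On the space `archSmooth ι` of functions `G → ℂ` smooth in the
archimedean variable, `X ↦ (ψ ↦ X ψ)` is a real Lie algebra representation (Borel–Jacquet 1979,
§1.5; Knapp 2002, I.§10 and III.§1; Dixmier, *Enveloping Algebras*, 2.1–2.2): `ℝ`-linear in `X`,
`ℂ`-linear in `ψ` (tree: `IsArchSmooth.lieDeriv_add_left`, `lieDeriv_add`), preserving smoothness
(`isArchSmooth_lieDeriv_of_lie_eq_top`) and compatible with brackets (`lieDeriv_bracket_of_top`).

* `lieDerivRep ι hH hc : 𝔤 →ₗ⁅ℝ⁆ End_ℂ (archSmooth ι)` — this representation (a definition), with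
  `lieDerivRep_apply_coe`; hence the algebra homomorphism
  `envelopingAction (lieDerivRep ι hH hc) : U(𝔤) →ₐ[ℝ] End_ℂ (archSmooth ι)` (tree, `GKModules`).
* `coe_envelopingAction_freeToEnveloping` — **the word action factors through `U(𝔤)` on smooth
  functions**: for every non-commutative polynomial `p ∈ ℝ⟨𝔤⟩` and smooth `ψ`,
  `p ψ` (`applyFree ι p ψ`, total, defined on words) equals the action of the image of `p` in
  `U(𝔤)`; consequently `applyFree_congr_of_top` — the named fact `applyFree_congr (ι := ι)` of
  `ArchimedeanCalculus` (`p ψ = q ψ` when `p`, `q` have the same image in `U(𝔤)`), and smoothness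
  of `p ψ` (`isArchSmooth_applyFree`).
* `applyFree_mul_ι` (formal: `(p · X) ψ = p (X ψ)`, any `H`), `applyFree_ι_mul`
  (`(X · p) ψ = X (p ψ)`), and for a *central* `p`: `applyFree_lieDeriv_of_isCentralWord`,
  `z (X ψ) = X (z ψ)`.
* `isZFinite_lieDeriv_of_top` — **Lie derivatives of smooth `Z(𝔤)`-finite functions are
  `Z(𝔤)`-finite** (Borel–Jacquet 1979, 4.3 (ii); Bump 1997, §3.3): the `Z(𝔤)`-orbit span of `X ψ`
  lies in the image of that of `ψ` under the linear map `X`.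
* `GL_n`: `applyFree_congr_gl`, `isZFinite_lieDeriv_gl`, `IsAutomorphicForm.zFinite_lieDeriv`.

Everything here is proved; the one definition is `lieDerivRep`.

## References

* A. Borel, H. Jacquet, *Automorphic forms and automorphic representations*, Proc. Sympos. Pure
  Math. 33 (1979), part 1, §1.5–1.6, 4.3 (ii) [BorelJacquet1979].
* A. W. Knapp, *Lie Groups Beyond an Introduction* (2002), I.§10, III.§1 [Knapp2002].
* D. Bump, *Automorphic Forms and Representations* (1997), §3.3 (PDF p. 292), Prop. 2.2.3
  [Bump1997].
-/

-- Mathlib idiom (Mathlib/Algebra/Lie/OfAssociative.lean); needed to mention Lie subalgebras of matrix algebras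
attribute [local instance 100] LieRing.ofAssociativeRing

noncomputable section

open scoped MatrixGroups Matrix ContDiff

namespace Literature.NumberTheory.Automorphic

section General

variable {A : Type*} [NormedCommRing A] [NormedAlgebra ℝ A] [NormedAlgebra ℚ A] [CompleteSpace A]
  [StarRing A] {N : Type*} [Fintype N] [DecidableEq N] {H : RealMatrixGroup A N}
  {G : Type*} [Group G] (ι : H.carrier →* G)

/-! ### Formal identities of the word action (any `H`) -/

/-- `iterLieDeriv` along a concatenation is the composite: `(w₁ ++ w₂) φ = w₁ (w₂ φ)`.
Borel–Jacquet 1979, §1.5. [cite: BorelJacquet1979, §1.5] -/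
theorem iterLieDeriv_append (w₁ w₂ : List H.lie) (φ : G → ℂ) :
    iterLieDeriv ι (w₁ ++ w₂) φ = iterLieDeriv ι w₁ (iterLieDeriv ι w₂ φ) := by
  induction w₁ with
  | nil => rfl
  | cons X w ih => rw [List.cons_append, iterLieDeriv_cons, ih, iterLieDeriv_cons]

omit [Group G] in
/-- The real scalar action on complex-valued functions is the complex one: `a • f = (a : ℂ) • f`
(pointwise `Complex.real_smul`; stated for the function-space instances used by `applyFree`). [folklore] -/
theorem real_smul_fun_eq_coe_smul (a : ℝ) (f : G → ℂ) : a • f = (a : ℂ) • f := by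
  funext x
  simp [Complex.real_smul]

/-- **`(p · X) φ = p (X φ)`** for every non-commutative polynomial `p ∈ ℝ⟨𝔤⟩` (formal: on the word
basis `(w · X) φ = w (X φ)` is the definition of `iterLieDeriv`; both sides are `ℝ`-linear in `p`).
Borel–Jacquet 1979, §1.5–1.6. [cite: BorelJacquet1979, §1.6] -/
theorem applyFree_mul_ι (p : FreeAlgebra ℝ H.lie) (X : H.lie) (φ : G → ℂ) :
    applyFree ι (p * FreeAlgebra.ι ℝ X) φ = applyFree ι p (lieDeriv ι X φ) := by
  -- both sides as `ℝ`-linear maps in `p`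
  let L : FreeAlgebra ℝ H.lie →ₗ[ℝ] (G → ℂ) :=
    { toFun := fun q => applyFree ι (q * FreeAlgebra.ι ℝ X) φ
      map_add' := fun q₁ q₂ => by rw [add_mul, applyFree_add]
      map_smul' := fun c q => by
        rw [smul_mul_assoc, applyFree_smul_left, RingHom.id_apply, real_smul_fun_eq_coe_smul] }
  let R : FreeAlgebra ℝ H.lie →ₗ[ℝ] (G → ℂ) :=
    { toFun := fun q => applyFree ι q (lieDeriv ι X φ)
      map_add' := fun q₁ q₂ => applyFree_add ι q₁ q₂ _
      map_smul' := fun c q => by rw [applyFree_smul_left, RingHom.id_apply, real_smul_fun_eq_coe_smul] }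
  suffices hLR : L = R from LinearMap.congr_fun hLR p
  refine (FreeAlgebra.basisFreeMonoid ℝ H.lie).ext fun w => ?_
  change applyFree ι (FreeAlgebra.basisFreeMonoid ℝ H.lie w * FreeAlgebra.ι ℝ X) φ =
    applyFree ι (FreeAlgebra.basisFreeMonoid ℝ H.lie w) (lieDeriv ι X φ)
  have hmul : FreeAlgebra.basisFreeMonoid ℝ H.lie w * FreeAlgebra.ι ℝ X =
      FreeAlgebra.basisFreeMonoid ℝ H.lie (w * FreeMonoid.of X) := by
    rw [basisFreeMonoid_eq_lift, basisFreeMonoid_eq_lift, map_mul, FreeMonoid.lift_eval_of]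
  rw [hmul, applyFree_basisFreeMonoid, applyFree_basisFreeMonoid, FreeMonoid.toList_mul,
    FreeMonoid.toList_of, iterLieDeriv_append]
  rfl

/-! ### The Lie algebra representation on smooth functions (`𝔤 = 𝔤𝔩(N, A)`) -/

variable [FiniteDimensional ℝ A]

/-- **The representation of `𝔤 = 𝔤𝔩(N, A)` on archimedean-smooth functions by Lie derivatives**:
`X ↦ (ψ ↦ X ψ)` as a morphism of real Lie algebras `𝔤 →ₗ⁅ℝ⁆ End_ℂ (archSmooth ι)`, for the full
linear group (`H.lie = ⊤`, `H.carrier = ⊤`) over a finite-dimensional coefficient algebra: `X ψ`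
is smooth (`isArchSmooth_lieDeriv_of_lie_eq_top`), `ℂ`-linear in `ψ` and `ℝ`-linear in `X` on
smooth functions, and `[X, Y] ↦ X Y - Y X` (`lieDeriv_bracket_of_top`).
Borel–Jacquet 1979, §1.5; Knapp 2002, I.§10, Prop. 1.89 and III.§1. [cite: BorelJacquet1979, §1.5] -/
def lieDerivRep (hH : H.lie = ⊤) (hc : H.carrier = ⊤) : H.lie →ₗ⁅ℝ⁆ Module.End ℂ (archSmooth ι) where
  toFun X :=
    { toFun := fun ψ => ⟨lieDeriv ι X ψ, (mem_archSmooth_iff ι _).2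
        (isArchSmooth_lieDeriv_of_lie_eq_top ι hH X ((mem_archSmooth_iff ι _).1 ψ.2))⟩
      map_add' := fun ψ₁ ψ₂ => Subtype.ext (IsArchSmooth.lieDeriv_add ι X
        ((mem_archSmooth_iff ι _).1 ψ₁.2) ((mem_archSmooth_iff ι _).1 ψ₂.2))
      map_smul' := fun c ψ => Subtype.ext (lieDeriv_smul X c (ψ : G → ℂ)) }
  map_add' X Y := LinearMap.ext fun ψ =>
    Subtype.ext (IsArchSmooth.lieDeriv_add_left ι ((mem_archSmooth_iff ι _).1 ψ.2) X Y)
  map_smul' a X := LinearMap.ext fun ψ => Subtype.ext (by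
    change lieDeriv ι (a • X) ψ = (a : ℂ) • lieDeriv ι X ψ
    rw [IsArchSmooth.lieDeriv_smul_left ι ((mem_archSmooth_iff ι _).1 ψ.2), real_smul_fun_eq_coe_smul])
  map_lie' {X Y} := LinearMap.ext fun ψ => Subtype.ext (by
    change lieDeriv ι ⁅X, Y⁆ ψ = lieDeriv ι X (lieDeriv ι Y ψ) - lieDeriv ι Y (lieDeriv ι X ψ)
    exact lieDeriv_bracket_of_top ι hH hc X Y ((mem_archSmooth_iff ι _).1 ψ.2))

variable {ι}

/-- Unfolding: `(lieDerivRep ι hH hc X) ψ = X ψ` as functions. [folklore] -/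
@[simp]
theorem lieDerivRep_apply_coe (hH : H.lie = ⊤) (hc : H.carrier = ⊤) (X : H.lie) (ψ : archSmooth ι) :
    ((lieDerivRep ι hH hc X ψ : archSmooth ι) : G → ℂ) = lieDeriv ι X ψ := rfl

/-- On a product `X₁ ⋯ Xₘ` of generators, `U(𝔤)` acts on smooth `ψ` by the iterated Lie
derivative `X₁ (⋯ (Xₘ ψ))`. Borel–Jacquet 1979, §1.5. [cite: BorelJacquet1979, §1.5] -/
theorem coe_lieDerivRep_prod (hH : H.lie = ⊤) (hc : H.carrier = ⊤)
    (l : List H.lie) (ψ : archSmooth ι) :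
    (((l.map (lieDerivRep ι hH hc)).prod ψ : archSmooth ι) : G → ℂ) = iterLieDeriv ι l ψ := by
  induction l with
  | nil => simp
  | cons X l ih =>
    rw [List.map_cons, List.prod_cons, Module.End.mul_apply, lieDerivRep_apply_coe, ih,
      iterLieDeriv_cons]

/-- **The word action factors through `U(𝔤)` on smooth functions**: for `p ∈ ℝ⟨𝔤⟩` and
smooth `ψ`, `p ψ = (image of p in U(𝔤)) · ψ` for the action `envelopingAction (lieDerivRep …)`.
Borel–Jacquet 1979, §1.5–1.6; Dixmier 2.1.1. [cite: BorelJacquet1979, §1.6] -/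
theorem coe_envelopingAction_freeToEnveloping (hH : H.lie = ⊤) (hc : H.carrier = ⊤)
    (p : FreeAlgebra ℝ H.lie) (ψ : archSmooth ι) :
    ((envelopingAction (lieDerivRep ι hH hc) (freeToEnveloping H p) ψ : archSmooth ι) : G → ℂ) =
      applyFree ι p ψ := by
  -- the composite `ℝ⟨𝔤⟩ → U(𝔤) → End`, evaluated at `ψ`, as an `ℝ`-linear map in `p`
  set Aρ : FreeAlgebra ℝ H.lie →ₐ[ℝ] Module.End ℂ (archSmooth ι) :=
    (envelopingAction (lieDerivRep ι hH hc)).comp (freeToEnveloping H) with hAρ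
  let R : FreeAlgebra ℝ H.lie →ₗ[ℝ] (G → ℂ) :=
    { toFun := fun q => ((Aρ q ψ : archSmooth ι) : G → ℂ)
      map_add' := fun q₁ q₂ => by rw [map_add, LinearMap.add_apply, Submodule.coe_add]
      map_smul' := fun a q => by
        rw [map_smul, LinearMap.smul_apply, RingHom.id_apply, real_smul_fun_eq_coe_smul]
        rfl }
  let L : FreeAlgebra ℝ H.lie →ₗ[ℝ] (G → ℂ) :=
    { toFun := fun q => applyFree ι q ψ
      map_add' := fun q₁ q₂ => applyFree_add ι q₁ q₂ _
      map_smul' := fun c q => by rw [applyFree_smul_left, RingHom.id_apply, real_smul_fun_eq_coe_smul] }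
  suffices hRL : R = L from LinearMap.congr_fun hRL p
  refine (FreeAlgebra.basisFreeMonoid ℝ H.lie).ext fun w => ?_
  change ((Aρ (FreeAlgebra.basisFreeMonoid ℝ H.lie w) ψ : archSmooth ι) : G → ℂ) =
    applyFree ι (FreeAlgebra.basisFreeMonoid ℝ H.lie w) ψ
  rw [applyFree_basisFreeMonoid, basisFreeMonoid_eq_lift, ← FreeMonoid.ofList_toList w,
    FreeMonoid.lift_apply, FreeMonoid.toList_ofList, hAρ, map_list_prod, List.map_map]
  have hcomp : ((envelopingAction (lieDerivRep ι hH hc)).comp (freeToEnveloping H) : _ → _) ∘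
      FreeAlgebra.ι ℝ = (lieDerivRep ι hH hc : H.lie → Module.End ℂ (archSmooth ι)) := by
    funext X
    change envelopingAction (lieDerivRep ι hH hc) (freeToEnveloping H (FreeAlgebra.ι ℝ X)) = _
    rw [freeToEnveloping_ι, envelopingAction_ι]
  rw [hcomp]
  exact coe_lieDerivRep_prod hH hc _ ψ

variable (ι) in
omit [FiniteDimensional ℝ A] in
/-- **Discharge of the named fact `applyFree_congr` for `𝔤 = 𝔤𝔩(N, A)`**: on archimedean-smooth
functions the word action factors through `U(𝔤)` — if `p`, `q ∈ ℝ⟨𝔤⟩` have the same image in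
`U(𝔤)` then `p φ = q φ` for smooth `φ` (full linear group, finite-dimensional coefficients).
Borel–Jacquet 1979, §1.5; Dixmier, *Enveloping Algebras*, 2.1.1. [cite: BorelJacquet1979, §1.5] -/
theorem applyFree_congr_of_top (hH : H.lie = ⊤) (hc : H.carrier = ⊤) : applyFree_congr (ι := ι) := by
  intro _ p q hpq φ hφ
  rw [← coe_envelopingAction_freeToEnveloping hH hc p ⟨φ, hφ⟩,
    ← coe_envelopingAction_freeToEnveloping hH hc q ⟨φ, hφ⟩, hpq]

/-- `p φ` is smooth for smooth `φ` and every `p ∈ ℝ⟨𝔤⟩` (it is the value of an endomorphism of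
`archSmooth ι`). Borel–Jacquet 1979, §1.5. [cite: BorelJacquet1979, §1.5] -/
theorem isArchSmooth_applyFree (hH : H.lie = ⊤) (hc : H.carrier = ⊤) (p : FreeAlgebra ℝ H.lie)
    {φ : G → ℂ} (hφ : IsArchSmooth ι φ) : IsArchSmooth ι (applyFree ι p φ) := by
  rw [← coe_envelopingAction_freeToEnveloping hH hc p ⟨φ, hφ⟩]
  exact (mem_archSmooth_iff ι _).1 (Subtype.coe_prop _)

/-- **`(X · p) φ = X (p φ)`** on smooth `φ`. Borel–Jacquet 1979, §1.5–1.6. [cite: BorelJacquet1979, §1.6] -/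
theorem applyFree_ι_mul (hH : H.lie = ⊤) (hc : H.carrier = ⊤) (X : H.lie)
    (p : FreeAlgebra ℝ H.lie) {φ : G → ℂ} (hφ : IsArchSmooth ι φ) :
    applyFree ι (FreeAlgebra.ι ℝ X * p) φ = lieDeriv ι X (applyFree ι p φ) := by
  rw [← coe_envelopingAction_freeToEnveloping hH hc _ ⟨φ, hφ⟩,
    ← coe_envelopingAction_freeToEnveloping hH hc p ⟨φ, hφ⟩, map_mul, map_mul,
    Module.End.mul_apply, freeToEnveloping_ι, envelopingAction_ι, lieDerivRep_apply_coe]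

/-- **Central elements commute with Lie derivatives**: for a central word `z` and smooth `φ`,
`z (X φ) = X (z φ)` (`z · X = X · z` in `U(𝔤)`). Borel–Jacquet 1979, §1.6 and 4.3 (ii).
[cite: BorelJacquet1979, 4.3 (ii)] -/
theorem applyFree_lieDeriv_of_isCentralWord (hH : H.lie = ⊤) (hc : H.carrier = ⊤)
    {p : FreeAlgebra ℝ H.lie} (hp : IsCentralWord p) (X : H.lie) {φ : G → ℂ} (hφ : IsArchSmooth ι φ) :
    applyFree ι p (lieDeriv ι X φ) = lieDeriv ι X (applyFree ι p φ) := by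
  rw [← applyFree_mul_ι, ← applyFree_ι_mul hH hc X p hφ]
  refine applyFree_congr_of_top ι hH hc ?_ hφ
  rw [map_mul, map_mul, freeToEnveloping_ι]
  exact ((Subalgebra.mem_center_iff.1 hp) _).symm

/-- **Lie derivatives of smooth `Z(𝔤)`-finite functions are `Z(𝔤)`-finite** (Borel–Jacquet 1979,
4.3 (ii); Bump 1997, §3.3), for the full linear group over a finite-dimensional coefficient algebra:
the `Z(𝔤)`-orbit span of `X φ` is contained in the image of the (finite-dimensional, smooth)
`Z(𝔤)`-orbit span of `φ` under the linear map `X` (`z (X φ) = X (z φ)`).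
[cite: BorelJacquet1979, 4.3 (ii)] -/
theorem isZFinite_lieDeriv_of_top (hH : H.lie = ⊤) (hc : H.carrier = ⊤) {φ : G → ℂ}
    (hφ : IsArchSmooth ι φ) (hZ : IsZFinite ι φ) (X : H.lie) : IsZFinite ι (lieDeriv ι X φ) := by
  -- the `Z(𝔤)`-orbit span `V` of `φ` is finite-dimensional and consists of smooth functions
  set V : Submodule ℂ (G → ℂ) := zOrbitSpan ι φ with hV_def
  haveI : FiniteDimensional ℂ V := hZ
  have hVsmooth : V ≤ archSmooth ι := by
    refine Submodule.span_le.2 ?_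
    rintro _ ⟨p, -, rfl⟩
    exact isArchSmooth_applyFree hH hc p hφ
  -- `X` restricted to `V`, a `ℂ`-linear map
  let Φ : V →ₗ[ℂ] (G → ℂ) :=
    { toFun := fun v => lieDeriv ι X (v : G → ℂ)
      map_add' := fun v₁ v₂ => IsArchSmooth.lieDeriv_add ι X (hVsmooth v₁.2) (hVsmooth v₂.2)
      map_smul' := fun c v => lieDeriv_smul X c (v : G → ℂ) }
  unfold IsZFinite
  refine Submodule.finiteDimensional_of_le (S₂ := LinearMap.range Φ) (Submodule.span_le.2 ?_)
  rintro _ ⟨p, hp, rfl⟩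
  rw [SetLike.mem_coe, applyFree_lieDeriv_of_isCentralWord hH hc hp X hφ]
  exact ⟨⟨applyFree ι p φ, Submodule.subset_span ⟨p, hp, rfl⟩⟩, rfl⟩

end General

/-! ### The `GL_n` datum -/

section GLn

open scoped Classical
open NumberField NumberField.mixedEmbedding IsDedekindDomain

variable {n : ℕ} {K : Type} [Field K] [NumberField K]

/-- **The word action factors through `U(𝔤)` on smooth functions on `GL_n(𝔸_K)`**: the named
fact `applyFree_congr` of `ArchimedeanCalculus` holds for the archimedean inclusion
`(AutomorphyDatum.gl n K hcpt).ofArch` (`𝔤 = 𝔤𝔩_n(K_∞)`, `G_∞ = GL_n(K_∞)` are everything).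
Borel–Jacquet 1979, §1.5 and §4.1. [cite: BorelJacquet1979, §1.5] -/
theorem applyFree_congr_gl (hcpt : isCompact_glFiniteIntegralLevel n K) :
    applyFree_congr (ι := (AutomorphyDatum.gl n K hcpt).ofArch) :=
  applyFree_congr_of_top _ (archGroupGL_lie n K) (archGroupGL_carrier n K)

/-- **Lie derivatives of smooth `Z(𝔤)`-finite functions on `GL_n(𝔸_K)` are `Z(𝔤)`-finite.**
Borel–Jacquet 1979, 4.3 (ii); Bump 1997, §3.3. [cite: BorelJacquet1979, 4.3 (ii)] -/
theorem isZFinite_lieDeriv_gl {hcpt : isCompact_glFiniteIntegralLevel n K}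
    {φ : (AdelicGroupData.gl n K).Adelic → ℂ}
    (hφ : IsArchSmooth (AutomorphyDatum.gl n K hcpt).ofArch φ)
    (hZ : IsZFinite (AutomorphyDatum.gl n K hcpt).ofArch φ)
    (X : (AutomorphyDatum.gl n K hcpt).arch.lie) :
    IsZFinite (AutomorphyDatum.gl n K hcpt).ofArch (lieDeriv (AutomorphyDatum.gl n K hcpt).ofArch X φ) :=
  isZFinite_lieDeriv_of_top (archGroupGL_lie n K) (archGroupGL_carrier n K) hφ hZ X

/-- In particular, **Lie derivatives of automorphic forms on `GL_n(𝔸_K)` are `Z(𝔤)`-finite**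
(Borel–Jacquet 1979, 4.3 (ii)). [cite: BorelJacquet1979, 4.3 (ii)] -/
theorem IsAutomorphicForm.zFinite_lieDeriv {hcpt : isCompact_glFiniteIntegralLevel n K}
    {φ : (AdelicGroupData.gl n K).Adelic → ℂ} (hφ : IsAutomorphicForm (AutomorphyDatum.gl n K hcpt) φ)
    (X : (AutomorphyDatum.gl n K hcpt).arch.lie) :
    IsZFinite (AutomorphyDatum.gl n K hcpt).ofArch (lieDeriv (AutomorphyDatum.gl n K hcpt).ofArch X φ) :=
  isZFinite_lieDeriv_gl hφ.archSmooth hφ.zFinite X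

end GLn

end Literature.NumberTheory.Automorphic
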